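import Summits.BirchSwinnertonDyer.BirchSwinnertonDyer.Theorems.ByReductionTypeAtTwoOrdKatoHalfAtTwoIsoHCEngine
import Summits.BirchSwinnertonDyer.BirchSwinnertonDyer.Theorems.ByReductionTypeAtTwoOrdKatoHalfAtTwoIsoOmegaRoadDefs
import Summits.BirchSwinnertonDyer.BirchSwinnertonDyer.Theorems.SmallImageMuTransferMuTransferX9StepTwoElementKernels
import Summits.BirchSwinnertonDyer.BirchSwinnertonDyer.Theorems.SmallImageMuTransferMuTransferX9StepOneResidue
import Literature.NumberTheory.GaloisRepresentations.ChebotarevOpenSubgroup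
import HarnessLib

/-!
# Route ByReductionTypeAtTwo, crux `OrdKatoHalfAtTwoIso` (stmt-BirchSwinnertonDyer-19573), line
# `steinberg-fibre-at-two` (skeleton v5): registered stub Ω1 = (H-C) `ChebotarevTranspositionTwo` —
# a Chebotarev prime `q ∉ S` whose Frobenius is a TRANSPOSITION on `E[2]`, of depth `≥ n`, with
# non-degenerate bottom pairing

Seat `cruxlead-stmt-BirchSwinnertonDyer-19573-g0` (LEAD PROVER, MODE LINE; stub-worker for Ω1). HONEST FRAMING (cell
bsd-2adic): BSD is not proved by any of this; the crux `OrdKatoHalfAtTwoIso` is not proved here; this file closes the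
registered stub Ω1 (`stub_HC_chebotarevTranspositionTwo : ChebotarevTranspositionTwo`) of line steinberg-fibre-at-two,
i.e. it PROVES the displayed statement (H-C) of `…OmegaRoadDefs.lean` §2. Credit: the statement (H-C) is sidea-stub_port-2's
(card #9, `STUB_IDEAS_stub_port_2_Helpers.lean`); the route is the stub-critic's STUB-PLAN F3 (plain Chebotarev for open
normal subgroups) + F5 (the `S₃`-stable subgroups of `E[2]²`). Engine: `…HCEngine.lean` (§§1–4). Theorems only; no
definition, no named fact, no `sorry`.

MATHEMATICS. `W/ℚ` elliptic with `ρ̄_{E,2}` onto (`S₃`) and `Δ < 0`; `κ` a `ℤ₂`-extension; `φ`, `ψ` continuous 1-cocycles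
of `𝒯_{J+1}(χ)`, `𝒯_{J+1}(χ⁻¹)` with `κ̄′ ≠ 0` resp. `T^J[ψ] ≠ 0`; `e` an alternating non-degenerate pairing on `E[2]`.
(1) A complex conjugation `c` lies in `ker κ` and is a transposition on `E[2] = {0, T₀, T₁, T₂}` (`Δ < 0`): its fixed
line is `ℓ = {0, P}` and `c x − x = P` off `ℓ`; with `e(x, y) ≠ 1` for `x ≠ y` non-zero this gives `e((c−1)x, y) ≠ 1`
for `x, y ∉ ℓ` (engine §2). (2) The BOTTOM cocycles `φ₀ = (φ)₀`, `ψ₀ = (ψ)₀` are cocycles of the SAME module `E[2]`; by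
Steinberg–Sah on the residue (engine §3 for `E[2]`; the tree's dual-twist form p658151) `φ₀` and `ψ₀` do not vanish on
`ker ρ̄₂ ⊓ ker κ` (§5: `[φ₀] = κ̄′ ≠ 0`; `T^J[ψ] = [S^J ∘ ψ]` and `S^J ∘ ψ` has only the coordinate `(ψ)₀`). (3) The joint
values `A = (φ₀, ψ₀)(G)`, `G := ker ρ̄₂ ⊓ Gal(ℚ̄/ℚ_n)`, form a `Γ_ℚ`-stable subgroup of `E[2]²` with both projections
non-zero; since `E[2]` is irreducible, `A = E[2]²` or `A` is the DIAGONAL (engine §4, F5). In the diagonal case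
`φ₀ − ψ₀` vanishes on `G`, hence is a coboundary `g ↦ gw − w` (Sah again), so `φ₀(c) − ψ₀(c) = cw − w ∈ ℓ`. Either way
some `a ∈ G` has `φ₀(a) + φ₀(c) ∉ ℓ` and `ψ₀(a) + ψ₀(c) ∉ ℓ`. (4) `σ := a c` is a transposition of depth `≥ n` with
`e((σ−1)φ₀(σ), ψ₀(σ)) ≠ 1`; the subgroup `N = {g ∈ G : φ₀ g = ψ₀ g = 0}` is open and normal (tree
`JointValue.exists_normal_isOpen_le_forall_apply_eq_zero`), and Chebotarev for `ℚ̄^N/ℚ` (tree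
`exists_isArithFrobAt_mul_inv_mem_not_mem`, F3) gives `q ∉ S` with `Frob ≡ σ (mod N)`; all five conclusions are constant
on `N`-cosets (§6).

References: B. Mazur, K. Rubin, *Kolyvagin systems*, Mem. AMS 799 (2004) §3.6, Prop. 1.3.2, §5.3 [MazurRubin2004]; J. Tate,
*Global class field theory*, Cassels–Fröhlich (1967) VII §2.4 [TateGCFT1967]; C.-H. Sah, J. Algebra 10 (1968) Prop. 2.7 (b)
[Sah1968]; the line's helpers p656928, p657595, p658151, p655368 (OmegaRoadDefs) and the engine `…HCEngine.lean`.
-/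

set_option autoImplicit false
set_option linter.dupNamespace false

noncomputable section

open scoped NumberField
open Field WeierstrassCurve Function IsDedekindDomain NumberField
open Literature.NumberTheory.EllipticCurves Literature.NumberTheory.GaloisRepresentations
open Literature.NumberTheory.EllipticCurves.DokchitserDokchitser2012
open Summit.BirchSwinnertonDyer.BirchSwinnertonDyer.Rank1Residual

-- D-0017: single-problem summit, so `Summit.BirchSwinnertonDyer.BirchSwinnertonDyer.…` repeats a namespace BY DESIGN.
namespace Summit.BirchSwinnertonDyer.BirchSwinnertonDyer.Theorems.SteinbergFibreAtTwo

/-! ## §5 The bottom cocycles `φ₀`, `ψ₀` of `E[2]` do not vanish on `ker ρ̄_{E,2} ⊓ ker κ` -/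

section Bottom

variable (W : WeierstrassCurve ℚ) [W.IsElliptic] (κ : ZpExtension ℚ 2)

/-- **`φ₀ = (φ)₀` does not vanish on `ker ρ̄₂ ⊓ ker κ`** when `φ` represents `κ'_{J+1}` with `κ̄' ≠ 0`: the class of
the bottom cocycle is `H¹(const)(κ'_{J+1}) = κ̄' ≠ 0` (`map_constCoeff_level_eq_towerConst`, `map_oneCocycleClass_twist`),
while a cocycle of `E[2]` vanishing there has zero class (§3). [cite: MazurRubin2004, §5.3] [cite: Sah1968, Prop. 2.7 (b)] -/
theorem exists_mem_constCoeff_apply_ne_zero_of_towerConst_ne_zero (h2 : W.HasSurjectiveModNGaloisRep 2)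
    (hΔ : W.Δ < 0)
    (κ' : κ.twistTower (W.torsionGaloisModule (2 : ℤ))
      (fun P : geomTorsion W (2 : ℤ) => AddSubgroup.torsionBy.nsmul P))
    (hκ' : κ.towerConst (W.torsionGaloisModule (2 : ℤ)) (fun P => AddSubgroup.torsionBy.nsmul P) κ' ≠ 0)
    (J : ℕ) (φ : contOneCocycles (W.modPTwist 2 κ (J + 1)).toTopRep)
    (hφ : oneCocycleClass (W.modPTwist 2 κ (J + 1)).toTopRep φ = κ'.1 (J + 1)) :
    ∃ ν ∈ (galoisRepTorsion W 2).ker ⊓ κ.kerSubgroup,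
      (κ.pushCocycle (W.torsionGaloisModule (2 : ℤ))
          (fun P : geomTorsion W (2 : ℤ) => AddSubgroup.torsionBy.nsmul P) (J + 1)
          (κ.twistModPConstCoeff (W.torsionGaloisModule (2 : ℤ))
            (fun P : geomTorsion W (2 : ℤ) => AddSubgroup.torsionBy.nsmul P) (J + 1) (Nat.succ_pos J)) φ).1 ν ≠ 0 := by
  by_contra hcon
  push Not at hcon
  have hc : galoisCohomology.map (κ.twistModPConstCoeff (W.torsionGaloisModule (2 : ℤ))
      (fun P : geomTorsion W (2 : ℤ) => AddSubgroup.torsionBy.nsmul P) (J + 1) (Nat.succ_pos J)) 1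
      (κ'.1 (J + 1)) ≠ 0 := by
    rw [LevelE.map_constCoeff_level_eq_towerConst]
    exact hκ'
  rw [← hφ] at hc
  change galoisCohomology.map _ 1 (oneCocycleClass (κ.twistModP (W.torsionGaloisModule (2 : ℤ))
    (fun P : geomTorsion W (2 : ℤ) => AddSubgroup.torsionBy.nsmul P) (J + 1)).toTopRep φ) ≠ 0 at hc
  rw [ZpExtension.map_oneCocycleClass_twist] at hc
  exact hc (torsion_two_oneCocycleClass_eq_zero_of_forall_mem_eq_zero_of_residue W κ h2 hΔ _ hcon)

/-- **`ψ₀ = (ψ)₀` does not vanish on `ker ρ̄₂ ⊓ ker κ`** when `T^J[ψ] ≠ 0` in `H¹(ℚ, 𝒯_{J+1}(χ⁻¹))`: `T^J[ψ]` is the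
class of `S^J ∘ ψ` (`shiftH1_iterate_oneCocycleClass`), whose only coordinate is the top one `= (ψ)₀`; if `(ψ)₀`
vanished on `ker ρ̄₂ ⊓ ker κ = ker ρ̄₂ ⊓ ker κ⁻¹`, so would `S^J ∘ ψ`, and its class would be `0` by the dual-twist
Steinberg–Sah lemma on the residue (p658151). [cite: MazurRubin2004, §5.3] [cite: Sah1968, Prop. 2.7 (b)] -/
theorem exists_mem_constCoeff_apply_ne_zero_of_shiftH1_iterate_ne_zero (h2 : W.HasSurjectiveModNGaloisRep 2)
    (hΔ : W.Δ < 0) (J : ℕ) (ψ : contOneCocycles (W.modPTwist 2 κ.invTwist (J + 1)).toTopRep)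
    (hψ : (κ.invTwist.shiftH1 (W.torsionGaloisModule (2 : ℤ))
        (fun P : geomTorsion W (2 : ℤ) => AddSubgroup.torsionBy.nsmul P) (J + 1))^[J]
      (oneCocycleClass (W.modPTwist 2 κ.invTwist (J + 1)).toTopRep ψ) ≠ 0) :
    ∃ ν ∈ (galoisRepTorsion W 2).ker ⊓ κ.kerSubgroup,
      (κ.invTwist.pushCocycle (W.torsionGaloisModule (2 : ℤ))
          (fun P : geomTorsion W (2 : ℤ) => AddSubgroup.torsionBy.nsmul P) (J + 1)
          (κ.invTwist.twistModPConstCoeff (W.torsionGaloisModule (2 : ℤ))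
            (fun P : geomTorsion W (2 : ℤ) => AddSubgroup.torsionBy.nsmul P) (J + 1) (Nat.succ_pos J)) ψ).1 ν ≠ 0 := by
  by_contra hcon
  push Not at hcon
  apply hψ
  change (κ.invTwist.shiftH1 (W.torsionGaloisModule (2 : ℤ))
      (fun P : geomTorsion W (2 : ℤ) => AddSubgroup.torsionBy.nsmul P) (J + 1))^[J]
    (oneCocycleClass (κ.invTwist.twistModP (W.torsionGaloisModule (2 : ℤ))
      (fun P : geomTorsion W (2 : ℤ) => AddSubgroup.torsionBy.nsmul P) (J + 1)).toTopRep ψ) = 0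
  rw [ZpExtension.shiftH1_iterate_oneCocycleClass]
  have key : oneCocycleClass _ (κ.invTwist.shiftPowCocycle (W.torsionGaloisModule (2 : ℤ))
        (fun P : geomTorsion W (2 : ℤ) => AddSubgroup.torsionBy.nsmul P) (J + 1) J ψ) =
      oneCocycleClass _ 0 :=
    invTwist_modPTwist_two_oneCocycleClass_eq_of_forall_mem_eq_of_residue W κ h2 hΔ (J + 1) _ 0
      fun ν hν => by
        rw [ZpExtension.shiftPowCocycle_apply]
        change _ = (0 : Fin (J + 1) → geomTorsion W (2 : ℤ))
        funext i
        rw [shiftEnd_pow_apply, Pi.zero_apply]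
        by_cases hi : (i : ℕ) < J
        · rw [dif_pos hi]
        · rw [dif_neg hi]
          have hi2 := i.2
          have hfin : (⟨(i : ℕ) - J, by omega⟩ : Fin (J + 1)) = ⟨0, Nat.succ_pos J⟩ :=
            Fin.ext (show (i : ℕ) - J = 0 by omega)
          rw [hfin]
          exact hcon ν hν
  exact key.trans (oneCocycleClass_zero _)

end Bottom

/-! ## §6 (H-C): the transposition prime -/

section Main

variable (W : WeierstrassCurve ℚ) [W.IsElliptic] (κ : ZpExtension ℚ 2)

/-- **(H-C) on the bottom cocycles.** For `ρ̄_{E,2}` onto, `Δ < 0`, two continuous 1-cocycles `φ₀`, `ψ₀` of `E[2]`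
that do not vanish on `ker ρ̄₂ ⊓ ker κ`, an alternating non-degenerate pairing `e` on `E[2]`, a finite set `S` of
places and `n : ℕ`: there is `q ∉ S` with a Frobenius `Fr` above it which is a transposition on `E[2]` (`ρ̄(Fr) ≠ 1`,
`ρ̄(Fr²) = 1`), lies in `Gal(ℚ̄/ℚ_n)`, and has `e((Fr − 1)φ₀(Fr), ψ₀(Fr)) ≠ 1`. Proof: §§2–4 give `a ∈ ker ρ̄₂ ⊓ Γ_{ℚ_n}`
with `φ₀(a) + φ₀(c)`, `ψ₀(a) + ψ₀(c) ∉ ℓ_c` (`c` complex conjugation), `σ := a c`; Chebotarev for the open normal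
subgroup `{g ∈ ker ρ̄₂ ⊓ Γ_{ℚ_n} : φ₀ g = ψ₀ g = 0}` at the class of `σ`.
[cite: MazurRubin2004, §3.6 and Prop. 1.3.2] [cite: TateGCFT1967, §2.4 (Tchebotarev density theorem) with Prop. 2.3] -/
theorem exists_isArithFrobAt_transposition_weilPairingHom_ne_zero (h2 : W.HasSurjectiveModNGaloisRep 2)
    (hΔ : W.Δ < 0) (φ₀ ψ₀ : contOneCocycles (W.torsionGaloisModule (2 : ℤ)).toTopRep)
    (hφ₀ : ∃ ν ∈ (galoisRepTorsion W 2).ker ⊓ κ.kerSubgroup, φ₀.1 ν ≠ 0)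
    (hψ₀ : ∃ ν ∈ (galoisRepTorsion W 2).ker ⊓ κ.kerSubgroup, ψ₀.1 ν ≠ 0)
    (eW : geomTorsion W (2 : ℤ) → geomTorsion W (2 : ℤ) → AlgebraicClosure ℚ)
    (hμ : ∀ S T, eW S T ^ 2 = 1)
    (hadd₁ : ∀ S₁ S₂ T, eW (S₁ + S₂) T = eW S₁ T * eW S₂ T)
    (hadd₂ : ∀ S T₁ T₂, eW S (T₁ + T₂) = eW S T₁ * eW S T₂)
    (halt : ∀ T, eW T T = 1) (hnondeg : ∀ T, (∀ S, eW S T = 1) → T = 0)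
    (S : Set (HeightOneSpectrum (𝓞 ℚ))) (hS : S.Finite) (n : ℕ) :
    ∃ q : HeightOneSpectrum (𝓞 ℚ), q ∉ S ∧ ∃ 𝔓 ∈ q.primesAbove, ∃ Fr : absoluteGaloisGroup ℚ,
      IsArithFrobAt (𝓞 ℚ) Fr 𝔓 ∧ galoisRepTorsion W 2 Fr ≠ 1 ∧ galoisRepTorsion W 2 (Fr * Fr) = 1 ∧
      Fr ∈ κ.layerSubgroup n ∧
      weilPairingHom W 2 eW hμ hadd₁ hadd₂ (Fr • φ₀.1 Fr - φ₀.1 Fr) (ψ₀.1 Fr) ≠ 0 := by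
  -- irreducibility of `E[2]` (from surjectivity)
  have hirr : ∀ B : AddSubgroup (geomTorsion W (2 : ℤ)),
      (∀ g : absoluteGaloisGroup ℚ, ∀ x ∈ B, g • x ∈ B) → B = ⊥ ∨ B = ⊤ :=
    hasIrreducibleModPGaloisRep_of_hasSurjectiveModNGaloisRep W 2 h2
  -- complex conjugation: a transposition in `ker κ`
  obtain ⟨c, hc⟩ := exists_isComplexConjugation (Rat.castHom ℝ)
  have hcκ : c ∈ κ.kerSubgroup := ZpExtension.mem_kerSubgroup_of_isComplexConjugation κ hc
  have hsign := sign_permGal_eq_neg_one_of_isComplexConjugation_of_Δ_neg W hc hΔ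
  have hcc : c * c = 1 := by rw [← pow_two]; exact hc.sq_eq_one
  obtain ⟨x₀, hx₀⟩ := exists_smul_ne_of_isComplexConjugation_of_Δ_neg W hc hΔ
  obtain ⟨P, hP0, hcP, hℓ, -⟩ := exists_fixedPoint_of_sign_permGal_eq_neg_one W hsign
  have hρc : galoisRepTorsion W 2 c ≠ 1 := fun h =>
    hx₀ ((mem_ker_galoisRepTorsion_two_iff W c).mp (MonoidHom.mem_ker.mpr h) x₀)
  -- `G = ker ρ̄₂ ⊓ Gal(ℚ̄/ℚ_n)`: open, normal, acts trivially on `E[2]`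
  set G : Subgroup (absoluteGaloisGroup ℚ) := (galoisRepTorsion W 2).ker ⊓ κ.layerSubgroup n with hG
  haveI hGn : G.Normal := Subgroup.normal_inf_normal _ _
  have hGV : ∀ τ ∈ G, ∀ x : (W.torsionGaloisModule (2 : ℤ)).toTopRep,
      (W.torsionGaloisModule (2 : ℤ)).toTopRep.ρ τ x = x :=
    fun τ hτ x => (mem_ker_galoisRepTorsion_two_iff W τ).mp (Subgroup.mem_inf.mp hτ).1 x
  have hGo : IsOpen (G : Set (absoluteGaloisGroup ℚ)) :=
    (W.isOpen_ker_galoisRepTorsion_holds (n := (2 : ℤ)) two_ne_zero).inter (κ.isOpen_layerSubgroup n)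
  have hNG : (galoisRepTorsion W 2).ker ⊓ κ.kerSubgroup ≤ G :=
    inf_le_inf_left _ (κ.kerSubgroup_le_layerSubgroup n)
  -- the joint values `A = (φ₀, ψ₀)(G)`
  set A := contOneCocycles.jointValueSubgroup φ₀ ψ₀ G hGV hGV with hA
  have hAst : ∀ g : absoluteGaloisGroup ℚ, ∀ z ∈ A, (g • z.1, g • z.2) ∈ A :=
    fun g z hz => contOneCocycles.smul_mem_jointValueSubgroup φ₀ ψ₀ G hGV hGV g hz
  obtain ⟨ν₁, hν₁, hφν₁⟩ := hφ₀
  obtain ⟨ν₂, hν₂, hψν₂⟩ := hψ₀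
  have hA1 : ∃ z ∈ A, z.1 ≠ 0 := ⟨(φ₀.1 ν₁, ψ₀.1 ν₁), ⟨ν₁, hNG hν₁, rfl⟩, hφν₁⟩
  have hA2 : ∃ z ∈ A, z.2 ≠ 0 := ⟨(φ₀.1 ν₂, ψ₀.1 ν₂), ⟨ν₂, hNG hν₂, rfl⟩, hψν₂⟩
  -- in the diagonal case `φ₀(c) − ψ₀(c) ∈ ℓ_c` (Sah for `φ₀ − ψ₀`)
  have hdiag : (∀ z ∈ A, z.1 = z.2) → c • (φ₀.1 c - ψ₀.1 c) = φ₀.1 c - ψ₀.1 c := by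
    intro hd
    have h0 : oneCocycleClass _ (φ₀ - ψ₀) = 0 :=
      torsion_two_oneCocycleClass_eq_zero_of_forall_mem_eq_zero_of_residue W κ h2 hΔ (φ₀ - ψ₀) fun ν hν => by
        have := hd (φ₀.1 ν, ψ₀.1 ν) ⟨ν, hNG hν, rfl⟩
        change φ₀.1 ν - ψ₀.1 ν = 0
        exact sub_eq_zero.mpr this
    obtain ⟨w, hw⟩ := (oneCocycleClass_eq_zero_iff _ _).mp h0
    have hwc : φ₀.1 c - ψ₀.1 c = c • w - w := hw c
    rw [hwc, smul_sub, ← mul_smul, hcc, one_smul, ← neg_sub (c • w) w]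
    exact neg_eq_self_geomTorsion_two W _
  -- the joint value `(φ₀ a, ψ₀ a)`, `a ∈ G`
  obtain ⟨z, hzA, hz1, hz2⟩ := exists_mem_stableProd_smul_add_ne hirr hP0 hcP hℓ A hAst hA1 hA2
    (φ₀.1 c) (ψ₀.1 c) hdiag hx₀
  obtain ⟨a, haG, rfl⟩ := hzA
  dsimp only at hz1 hz2
  -- `σ := a c`
  have haρ : a ∈ (galoisRepTorsion W 2).ker := (Subgroup.mem_inf.mp haG).1
  have hσn : a * c ∈ κ.layerSubgroup n :=
    (κ.layerSubgroup n).mul_mem (Subgroup.mem_inf.mp haG).2 (κ.kerSubgroup_le_layerSubgroup n hcκ)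
  have hρσ : galoisRepTorsion W 2 (a * c) = galoisRepTorsion W 2 c := by
    rw [map_mul, MonoidHom.mem_ker.mp haρ, one_mul]
  have hφσ : φ₀.1 (a * c) = φ₀.1 a + φ₀.1 c := contOneCocycles.apply_mul_of_fixed φ₀ (hGV a haG) c
  have hψσ : ψ₀.1 (a * c) = ψ₀.1 a + ψ₀.1 c := contOneCocycles.apply_mul_of_fixed ψ₀ (hGV a haG) c
  have hσx : ∀ x : geomTorsion W (2 : ℤ), (a * c) • x = c • x := fun x => by
    rw [mul_smul, (mem_ker_galoisRepTorsion_two_iff W a).mp haρ]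
  -- the open normal subgroup `N = {g ∈ G : φ₀ g = ψ₀ g = 0}`
  obtain ⟨N, hNn, hNo, hNK, hNL, hNφ, hNψ⟩ :=
    JointValue.exists_normal_isOpen_le_forall_apply_eq_zero φ₀ ψ₀ G hGV hGV hGo (κ.layerSubgroup n)
      (κ.isOpen_layerSubgroup n) (isOpen_discrete _) (isOpen_discrete _)
  haveI := hNn
  -- Chebotarev at the class of `σ`
  obtain ⟨q, hqS, -, 𝔓, h𝔓, Fr, hFr, hFrσ⟩ :=
    exists_isArithFrobAt_mul_inv_mem_not_mem ℚ N hNo (a * c) S hS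
  -- transport along the coset `Fr = ν σ`, `ν ∈ N`
  have hνG : Fr * (a * c)⁻¹ ∈ G := hNK hFrσ
  have hFrν : Fr = Fr * (a * c)⁻¹ * (a * c) := by rw [inv_mul_cancel_right]
  have hρFr : galoisRepTorsion W 2 Fr = galoisRepTorsion W 2 c := by
    rw [hFrν, map_mul, MonoidHom.mem_ker.mp (Subgroup.mem_inf.mp hνG).1, one_mul, hρσ]
  have hφFr : φ₀.1 Fr = φ₀.1 (a * c) := by
    rw [hFrν, contOneCocycles.apply_mul_of_fixed φ₀ (hGV _ hνG) (a * c), hNφ _ hFrσ, zero_add]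
  have hψFr : ψ₀.1 Fr = ψ₀.1 (a * c) := by
    rw [hFrν, contOneCocycles.apply_mul_of_fixed ψ₀ (hGV _ hνG) (a * c), hNψ _ hFrσ, zero_add]
  have hFrx : ∀ x : geomTorsion W (2 : ℤ), Fr • x = c • x := fun x => by
    rw [hFrν, mul_smul, hσx]
    exact (mem_ker_galoisRepTorsion_two_iff W _).mp (Subgroup.mem_inf.mp hνG).1 (c • x)
  refine ⟨q, hqS, 𝔓, h𝔓, Fr, hFr, ?_, ?_, ?_, ?_⟩
  · rw [hρFr]
    exact hρc
  · rw [map_mul, hρFr, ← map_mul, hcc, map_one]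
  · rw [hFrν]
    exact (κ.layerSubgroup n).mul_mem (hNL hFrσ) hσn
  · rw [hφFr, hψFr, hFrx, hφσ, hψσ]
    exact weilPairingHom_two_smul_sub_ne_zero W eW hμ hadd₁ hadd₂ halt hnondeg hsign hz1 hz2

/-- **Registered stub Ω1 (H-C) of line `steinberg-fibre-at-two`**: `ChebotarevTranspositionTwo` holds — a Chebotarev
prime `q ∉ S` whose Frobenius is a transposition on `E[2]`, of depth `≥ n`, with non-degenerate bottom pairing
`e₂((ρ̄(Fr) − 1)·φ(Fr)₀, ψ(Fr)₀) ≠ 0`. The bottom cocycles `(φ)₀`, `(ψ)₀` are cocycles of `E[2]` non-vanishing on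
`ker ρ̄₂ ⊓ ker κ` (§5), and `exists_isArithFrobAt_transposition_weilPairingHom_ne_zero` applies.
[cite: MazurRubin2004, §3.6 and Prop. 1.3.2] [cite: TateGCFT1967, §2.4 (Tchebotarev density theorem) with Prop. 2.3] -/
theorem stub_HC_chebotarevTranspositionTwo : ChebotarevTranspositionTwo := by
  unfold ChebotarevTranspositionTwo
  intro W _ _ κ _ h2 hΔ _ _ κ' hκ' J φ hφ ψ hψ eW hμ hadd₁ hadd₂ halt hnondeg _ S hS n
  obtain ⟨q, hq, 𝔓, h𝔓, Fr, hFr, hρ1, hρ2, hFrn, hne⟩ :=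
    exists_isArithFrobAt_transposition_weilPairingHom_ne_zero W κ h2 hΔ _ _
      (exists_mem_constCoeff_apply_ne_zero_of_towerConst_ne_zero W κ h2 hΔ κ' hκ' J φ hφ)
      (exists_mem_constCoeff_apply_ne_zero_of_shiftH1_iterate_ne_zero W κ h2 hΔ J ψ hψ)
      eW hμ hadd₁ hadd₂ halt hnondeg S hS n
  exact ⟨q, hq, 𝔓, h𝔓, Fr, hFr, hρ1, hρ2, hFrn, hne⟩

end Main

end Summit.BirchSwinnertonDyer.BirchSwinnertonDyer.Theorems.SteinbergFibreAtTwo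

end
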